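import Literature.AnabelianGeometry.SemiGraphs.FiniteEtaleCoveringCompGlobal
import Literature.AnabelianGeometry.SemiGraphs.FiniteEtaleCoveringCompVertexAligned
import Literature.AnabelianGeometry.SemiGraphs.CoverticialRemark241OfComp
import HarnessLib

/-!
# Composites of finite étale coverings: ASSEMBLY of the four clauses, and [SemiAnbd] Rmk. 2.4.1
# reduced to the local and branch-alignment clauses of a composite

Mochizuki, *Semi-graphs of anabelioids*, Publ. RIMS **42** (2006) 221–322, §2: Def. 2.2 (i) p. 23,
Rmk. 2.4.1 p. 26, Rmk. 2.4.2 p. 26 (1-morphisms "form a category").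
[cite: MochizukiSemiAnbd2006, Rem. 2.4.1 p.26] [cite: MochizukiSemiAnbd2006, Def. 2.2(i) p.23]

PROOF-ONLY (abc-iut cell, F wave, FACT-LIST row F-1478, seat abc-iut-f-161 = assembly seat of the
§2 residual «print's finite étale coverings compose», L3-lead booking 10:1xZ: G = f-161, V = f-160,
L = w5-d041, B = w5-d177).  Print's covering notion is `Hom.IsFiniteEtaleCoveringGlobal` =
`∃ A, local A ∧ global A ∧ branch-aligned ∧ vertex-aligned`; for a composite `ψ.comp φ`
(`ψ : 𝒢'' → 𝒢'` over `B`, `φ : 𝒢' → 𝒢` over `A`) the four clauses must hold over ONE object of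
`B(𝒢)`, which we fix as `C := (α⁻¹ B).left` for a chosen global datum `(α, e)` of `φ`
(`φ^* ≅ (A × −) ⋙ α`).  In the kernel: global over `C` (`Hom.IsGlobalCoveringOf.comp_explicit`,
f-161) and vertex-aligned (`Hom.IsVertexAligned.comp`, f-160).  This file assembles, taking the two
outstanding clauses VERBATIM as hypotheses (no new `Prop` is named):

* `Hom.isFiniteEtaleCoveringGlobal_comp_of` — `(ψ.comp φ).IsFiniteEtaleCoveringGlobal` from (L) the
  local description of the composite over `(α⁻¹ B).left` (for every global datum `(α, e)` of `φ`,
  given all clauses of both factors) and (B) branch alignment of the composite;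
* `remark_2_4_1_covering_of_local_and_branchAligned_comp` — hence the named fact F-1478
  (`remark_2_4_1_covering`) from (L) and (B) alone, via
  `remark_2_4_1_covering_of_comp_isFiniteEtaleCoveringGlobal` (p431784).

Honest framing: typed ≠ proved for (L), (B); they are exactly what remains of F-1478.  Nothing here
takes a side on [IUTchIII] Cor. 3.12.
-/

namespace Literature.AnabelianGeometry.SemiGraphs

open CategoryTheory CategoryTheory.Limits

universe v₁ u₁ u

namespace SemiGraphOfAnabelioids

/-- **The four clauses of a composite, assembled.**  Let `ψ : 𝒢'' → 𝒢'` and `φ : 𝒢' → 𝒢` be finite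
étale coverings in print's sense.  ASSUME (L): whenever both factors satisfy all their clauses, for
every global datum `(α, e)` of `φ` over `A` the composite is LOCALLY the covering attached to
`(α⁻¹ B).left` (`B` the object of `ψ`); and (B): composites of print's coverings are branch-aligned.
THEN `ψ.comp φ` is a finite étale covering in print's sense: over `C := (α⁻¹ B).left` the local clause
is (L), the global clause is `Hom.IsGlobalCoveringOf.comp_explicit`, branch alignment is (B), vertex
alignment is abc-iut-f-160's `Hom.IsVertexAligned.comp`. [cite: MochizukiSemiAnbd2006, Def. 2.2(i) p.23] -/
theorem Hom.isFiniteEtaleCoveringGlobal_comp_of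
    (hL : ∀ {𝒢 𝒢' 𝒢'' : SemiGraphOfAnabelioids.{v₁, u₁, u}} (ψ : Hom 𝒢'' 𝒢') (φ : Hom 𝒢' 𝒢)
      (B : 𝒢'.BObj) (A : 𝒢.BObj),
      ψ.IsFiniteEtaleCoveringOf B → ψ.IsGlobalCoveringOf B → ψ.IsBranchAligned → ψ.IsVertexAligned →
      φ.IsFiniteEtaleCoveringOf A → φ.IsBranchAligned → φ.IsVertexAligned →
      ∀ [HasBinaryProducts 𝒢.BObj] (α : Over A ⥤ 𝒢'.BObj) [α.IsEquivalence],
        (φ.pullbackFunctor ≅ Over.star A ⋙ α) →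
          (ψ.comp φ).IsFiniteEtaleCoveringOf (α.inv.obj B).left)
    (hB : ∀ {𝒢 𝒢' 𝒢'' : SemiGraphOfAnabelioids.{v₁, u₁, u}} (ψ : Hom 𝒢'' 𝒢') (φ : Hom 𝒢' 𝒢),
      ψ.IsFiniteEtaleCoveringGlobal → φ.IsFiniteEtaleCoveringGlobal → (ψ.comp φ).IsBranchAligned)
    {𝒢 𝒢' 𝒢'' : SemiGraphOfAnabelioids.{v₁, u₁, u}} {ψ : Hom 𝒢'' 𝒢'} {φ : Hom 𝒢' 𝒢}
    (hψ : ψ.IsFiniteEtaleCoveringGlobal) (hφ : φ.IsFiniteEtaleCoveringGlobal) :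
    (ψ.comp φ).IsFiniteEtaleCoveringGlobal := by
  have hV : (ψ.comp φ).IsVertexAligned := Hom.IsFiniteEtaleCoveringGlobal.isVertexAligned_comp hψ hφ
  have hBr : (ψ.comp φ).IsBranchAligned := hB ψ φ hψ hφ
  obtain ⟨B, hψl, hψg, hψb, hψv⟩ := hψ
  obtain ⟨A, hφl, hφg, hφb, hφv⟩ := hφ
  obtain ⟨instG, α, hα, ⟨e⟩⟩ := hφg
  letI := instG
  haveI := hα
  exact ⟨(α.inv.obj B).left, hL ψ φ B A hψl hψg hψb hψv hφl hφb hφv α e,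
    Hom.IsGlobalCoveringOf.comp_explicit hψg α e, hBr, hV⟩

/-- **[SemiAnbd] Remark 2.4.1 along finite étale coverings (FACT-LIST F-1478) from the two outstanding
clauses**: if (L) composites of print's coverings are locally the covering attached to `(α⁻¹ B).left`
and (B) composites of print's coverings are branch-aligned, then `remark_2_4_1_covering` holds
(the global and vertex-alignment clauses of composites are kernel theorems, and the named fact is
reduced to the composition closure by `remark_2_4_1_covering_of_comp_isFiniteEtaleCoveringGlobal`).
[cite: MochizukiSemiAnbd2006, Rem. 2.4.1 p.26] -/
theorem remark_2_4_1_covering_of_local_and_branchAligned_comp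
    (hL : ∀ {𝒢 𝒢' 𝒢'' : SemiGraphOfAnabelioids.{v₁, u₁, u}} (ψ : Hom 𝒢'' 𝒢') (φ : Hom 𝒢' 𝒢)
      (B : 𝒢'.BObj) (A : 𝒢.BObj),
      ψ.IsFiniteEtaleCoveringOf B → ψ.IsGlobalCoveringOf B → ψ.IsBranchAligned → ψ.IsVertexAligned →
      φ.IsFiniteEtaleCoveringOf A → φ.IsBranchAligned → φ.IsVertexAligned →
      ∀ [HasBinaryProducts 𝒢.BObj] (α : Over A ⥤ 𝒢'.BObj) [α.IsEquivalence],
        (φ.pullbackFunctor ≅ Over.star A ⋙ α) →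
          (ψ.comp φ).IsFiniteEtaleCoveringOf (α.inv.obj B).left)
    (hB : ∀ {𝒢 𝒢' 𝒢'' : SemiGraphOfAnabelioids.{v₁, u₁, u}} (ψ : Hom 𝒢'' 𝒢') (φ : Hom 𝒢' 𝒢),
      ψ.IsFiniteEtaleCoveringGlobal → φ.IsFiniteEtaleCoveringGlobal → (ψ.comp φ).IsBranchAligned) :
    Literature.AnabelianGeometry.SemiGraphs.SemiGraphOfAnabelioids.remark_2_4_1_covering.{v₁, u₁, u} :=
  remark_2_4_1_covering_of_comp_isFiniteEtaleCoveringGlobal fun _ _ _ _ _ hψ hφ =>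
    Hom.isFiniteEtaleCoveringGlobal_comp_of hL hB hψ hφ

end SemiGraphOfAnabelioids

end Literature.AnabelianGeometry.SemiGraphs
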